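import Summits.QuantumFields.YangMills.Theorems.BalabanUVNodesN15PartitionPeriodic
import HarnessLib

/-!
# THE SMOOTH CUT-OFF WITH A PLATEAU (the bump `χ̃_□` of the dressed cubes), I: the ONE-DIMENSIONAL PROFILE `B_R(t) = Θ(max(|t| − R, 0))` — `= 1` on `|t| ≤ R`, `= 0` off
# `|t| < R + 1`, `0 ≤ B_R ≤ 1`, `π`-Lipschitz, second differences `≤ 16π⁴η²`; and ON THE CIRCLE of `K` cells `B_{K,R} = B_R ∘ v_K` with the same letters (`K ≥ 2R + 4` for the
# second difference) (dag-n15-w4 g3, width seat on N15 = NE2; dag-n15-w3 g4's located item (r2) «the bump instance»; s1 «background-layer OPERATOR ingredient»)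

Cell `pub-ymgap`, seat `pub-ymgap-dag-n15-w4` (director №399 (3a) width; HUMAN RULING D-0062), generation 3.  `bears_on: R4∕N15 · K3⁸ SpineGivenEndpointR13SepCoPHV
(stmt-QuantumFields-27366)`.  Filed `--supports stmt-QuantumFields-27366 --as helper` — COUNT-NEUTRAL.  Two plumbing `def`s (`bumpP`, `bumpPer`; review-queued, D-0009), the rest
theorems; 0 `sorry`.  Imports BY NAME dag-n15-c FILE 60 `…N15PartitionPeriodic` (`cenRep`, `cenRep_add_int_mul`, `abs_cenRep_le`, `abs_abs_cenRep_sub_le`) and through it FILE 59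
`…N15PartitionProfile` (`thetaP`, `phiP`, `phiP_zero`, `phiP_le_sq`, `thetaP_of_abs_le`, `thetaP_eq_zero_of_one_le_abs`, `thetaP_nonneg`, `abs_thetaP_le_one`, `thetaP_neg`,
`abs_thetaP_sub_le`, `abs_thetaP_second_diff_le`).  Nothing in the tree is modified.

WHY.  dag-n15-w3's dressed smooth-cut cubes (files 29–45 of the `…N15.CurvedSpecies` lineage; capstones 44 `hasMaj_glueInv_smoothCutDressed` ∕ `glueInv_smoothCutDressed_inverse` and 45
`hasMaj_idef_glueInv_smoothCutDressed`) display, per cube, a BUMP `χ̃_□` with `|χ̃| ≤ 1`, difference quotients `|∇^±χ̃| ≤ c_t`, a PLATEAU containing the partition function's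
support and its one-step neighbourhood (`M_{h_k}∘(Σ∇*∇ + W)∘M_{1−χ̃_k} = 0`), a support inside the input cut `χ_□` together with its one-step shifts and difference quotients
(`M_{χ̃}M_χ = M_{χ̃}`, `M_{χ̃∘τ^{±1}}M_χ = M_{χ̃∘τ^{±1}}`, `M_{∇^±χ̃}M_χ = M_{∇^±χ̃}`), and two-grid fits of its values and difference quotients ([B9] (3.62)–(3.65) pp.402–403 ∕
[B6] (2.36) p.229: shapes).  The located producer (dag-n15-w3 g4 ■, item (r2)) is a smooth plateau profile sampled on the lattice exactly as FILES 59–61 sample the partition.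
THIS FILE is its one-dimensional half: §1 `bumpP R t := Θ(max(|t| − R, 0))` — FILE 59's profile `Θ` run outward from a plateau of half-width `R` (the junction at `|t| = R` is
`C²`-flat because `Θ′(0) = Θ″(0) = 0`): `thetaP_zero`, `bumpP_nonneg` ∕ `bumpP_le_one` ∕ `abs_bumpP_le_one` ∕ `bumpP_neg`, ★ `bumpP_eq_one_of_abs_le` (plateau), ★
`bumpP_eq_zero_of_le_abs` (support), ★★ `abs_bumpP_sub_le` (`π`-Lipschitz — `max(·, 0)` and `|·|` are 1-Lipschitz), ★ `one_sub_thetaP_le` (NEAR-END FLATNESS `1 − Θ(u) ≤ 2π⁴u⁴` on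
`[0, 1]`: `φ(u) ≤ 4πu²` and `1 − cos x ≤ x²∕2`), the half-profile letters `abs_halfP_second_diff_le` (`g(v) = Θ(max(v, 0))`: interior = FILE 59's `12π²η²`, junction = flatness) and ★★
`abs_bumpP_second_diff_le` (`|B_R(t+η) − 2B_R(t) + B_R(t−η)| ≤ 16π⁴η²`, `0 ≤ η ≤ 1`, every `R ≥ 0` — for `R < 0` the profile has a kink at `0`); §2 the periodization `bumpPer K R u := bumpP R (cenRep K u)`: period, size, ★
plateau ∕ support in terms of the circle distance `|v_K|`, ★★ `abs_bumpPer_sub_le` (`≤ π|u − u′|` for EVERY `K ≥ 1` with no seam condition — `B_R` reads `|v_K|`, which is 1-Lipschitz by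
FILE 60 `abs_abs_cenRep_sub_le`), ★ `bumpP_cenRep_eq` (any representative of size `≤ K∕2 + 1` may replace `v_K` once `K ≥ 2R + 4`) and ★★ `abs_bumpPer_second_diff_le` (`≤ 16π⁴s²`).
Sequels (same seat): the lattice sampling `Π_ν B_{K,R}(ξ_ν − k_ν)` on any carrier with the plateau∕support∕cut identities (II), the two-grid fits (III), King's torus pair (IV).

HONEST FRAMING ∕ LIMITS.  Elementary real analysis; [B6] (2.36) p.229 and [B9] (3.62)–(3.65) pp.402–403 are SHAPES only — nothing of [B5]∕[B6]∕[B9] asserted; which plateau radius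
`R`, which input cut `χ_□` and which blocks the consumer uses is NOT chosen here.  NE2⁺ NOT PRINTED, NOT proved; N15 NOT discharged; counts of record UNMOVED (typed 28∕28 ·
discharged 5∕27); one finite 𝕋⁴ at fixed ε — NOT infinite volume, NOT OS on ℝ⁴, NOT a mass gap, NOT Clay; R4 closes the conditional finite-𝕋⁴ rung `BalabanLadder.UV` only.
Restate-immune (no Theses import).
-/

noncomputable section

namespace Summit.QuantumFields.YangMills.BalabanUVNodes.N15.Gluing

open Real

/-! ## §1 The plateau profile on the line -/

/-- **THE PLATEAU PROFILE** `B_R(t) = Θ(max(|t| − R, 0))`: FILE 59's `Θ` run outward from a plateau of half-width `R`. [cite: Balaban1985BackgroundPropagators, (3.62)–(3.65) pp.402–403 (the smooth cut-off of the cube: shape); Balaban1984PropagatorsII, (2.36) p.229 (profile requirements: shape)] -/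
def bumpP (R t : ℝ) : ℝ := thetaP (max (|t| - R) 0)

/-- `Θ(0) = 1`. [folklore] -/
theorem thetaP_zero : thetaP 0 = 1 := by
  rw [thetaP_of_abs_le (by rw [abs_zero]; exact zero_le_one), phiP_zero, mul_zero, Real.cos_zero]

/-- `0 ≤ B_R`. [folklore] -/
theorem bumpP_nonneg (R t : ℝ) : 0 ≤ bumpP R t := thetaP_nonneg _

/-- `|B_R| ≤ 1`. [folklore] -/
theorem abs_bumpP_le_one (R t : ℝ) : |bumpP R t| ≤ 1 := abs_thetaP_le_one _

/-- `B_R ≤ 1`. [folklore] -/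
theorem bumpP_le_one (R t : ℝ) : bumpP R t ≤ 1 := (le_abs_self _).trans (abs_bumpP_le_one R t)

/-- `B_R` is even. [folklore] -/
theorem bumpP_neg (R t : ℝ) : bumpP R (-t) = bumpP R t := by
  unfold bumpP; rw [abs_neg]

/-- ★ **THE PLATEAU**: `|t| ≤ R ⟹ B_R(t) = 1`. [cite: Balaban1985BackgroundPropagators, (3.62)–(3.65) pp.402–403 (shape)] -/
theorem bumpP_eq_one_of_abs_le {R t : ℝ} (h : |t| ≤ R) : bumpP R t = 1 := by
  unfold bumpP
  rw [max_eq_right (by linarith), thetaP_zero]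

/-- ★ **THE SUPPORT**: `R + 1 ≤ |t| ⟹ B_R(t) = 0`. [cite: Balaban1985BackgroundPropagators, (3.62)–(3.65) pp.402–403 (shape)] -/
theorem bumpP_eq_zero_of_le_abs {R t : ℝ} (h : R + 1 ≤ |t|) : bumpP R t = 0 := by
  unfold bumpP
  rw [max_eq_left (by linarith)]
  exact thetaP_eq_zero_of_one_le_abs (by rw [abs_of_nonneg (by linarith)]; linarith)

/-- The half-profile `g(v) = Θ(max(v, 0))` is `π`-Lipschitz. [folklore] -/
theorem abs_thetaP_max_sub_le (v v' : ℝ) : |thetaP (max v 0) - thetaP (max v' 0)| ≤ π * |v - v'| :=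
  (abs_thetaP_sub_le _ _).trans (mul_le_mul_of_nonneg_left (abs_max_sub_max_le_abs v v' 0) Real.pi_pos.le)

/-- `B_R` through the absolute value: `|B_R(t) − B_R(t′)| ≤ π·||t| − |t′||`. [folklore] -/
theorem abs_bumpP_sub_le_abs_abs (R t t' : ℝ) : |bumpP R t - bumpP R t'| ≤ π * |(|t| - |t'|)| := by
  unfold bumpP
  refine (abs_thetaP_max_sub_le _ _).trans (le_of_eq ?_)
  rw [show |t| - R - (|t'| - R) = |t| - |t'| by ring]

/-- ★★ **THE LIPSCHITZ LETTER** `|B_R(t) − B_R(t′)| ≤ π|t − t′|`. [cite: Balaban1984PropagatorsII, (2.36) p.229 («|∂h| ≤ O(1)M⁻¹»: shape)] -/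
theorem abs_bumpP_sub_le (R t t' : ℝ) : |bumpP R t - bumpP R t'| ≤ π * |t - t'| :=
  (abs_bumpP_sub_le_abs_abs R t t').trans (mul_le_mul_of_nonneg_left (abs_abs_sub_abs_le t t') Real.pi_pos.le)

/-- ★ **NEAR-END FLATNESS of `Θ`**: `0 ≤ u ≤ 1 ⟹ 1 − Θ(u) ≤ 2π⁴u⁴` (`Θ(u) = cos((π∕2)φ(u))`, `0 ≤ φ(u) ≤ 4πu²`, `1 − cos x ≤ x²∕2`). [folklore] -/
theorem one_sub_thetaP_le {u : ℝ} (h0 : 0 ≤ u) (h1 : u ≤ 1) : 1 - thetaP u ≤ 2 * π ^ 4 * u ^ 4 := by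
  rw [thetaP_of_abs_le (by rw [abs_of_nonneg h0]; exact h1)]
  obtain ⟨hφ0, hφ⟩ := phiP_le_sq h0
  have hc := Real.one_sub_sq_div_two_le_cos (x := π / 2 * phiP u)
  have hx : 0 ≤ π / 2 * phiP u := by positivity
  have hx1 : π / 2 * phiP u ≤ 2 * π ^ 2 * u ^ 2 := by nlinarith [Real.pi_pos]
  have hsq : (π / 2 * phiP u) ^ 2 ≤ (2 * π ^ 2 * u ^ 2) ^ 2 := pow_le_pow_left₀ hx hx1 2
  nlinarith

/-- `0 ≤ 1 − Θ(u)`. [folklore] -/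
theorem one_sub_thetaP_nonneg (u : ℝ) : 0 ≤ 1 - thetaP u := by
  linarith [(le_abs_self _).trans (abs_thetaP_le_one u)]

/-- The half-profile at nonpositive argument is `1`. [folklore] -/
theorem thetaP_max_of_nonpos {v : ℝ} (h : v ≤ 0) : thetaP (max v 0) = 1 := by
  rw [max_eq_right h, thetaP_zero]

/-- The half-profile at nonnegative argument is `Θ`. [folklore] -/
theorem thetaP_max_of_nonneg {v : ℝ} (h : 0 ≤ v) : thetaP (max v 0) = thetaP v := by
  rw [max_eq_left h]

/-- Flatness of the half-profile at the junction: `v ≤ η`, `0 ≤ η ≤ 1` ⟹ `|Θ(max(v,0)) − 1| ≤ 2π⁴η²`. [folklore] -/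
theorem abs_thetaP_max_sub_one_le {v η : ℝ} (hv : v ≤ η) (hη : 0 ≤ η) (hη1 : η ≤ 1) : |thetaP (max v 0) - 1| ≤ 2 * π ^ 4 * η ^ 2 := by
  rcases le_or_gt v 0 with h | h
  · rw [thetaP_max_of_nonpos h, sub_self, abs_zero]; positivity
  · rw [thetaP_max_of_nonneg h.le, abs_sub_comm, abs_of_nonneg (one_sub_thetaP_nonneg v)]
    refine (one_sub_thetaP_le h.le (hv.trans hη1)).trans ?_
    have h4 : v ^ 4 ≤ η ^ 4 := pow_le_pow_left₀ h.le hv 4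
    have hη2 : η ^ 4 ≤ η ^ 2 := by nlinarith [sq_nonneg η, mul_le_one₀ hη1 hη hη1]
    nlinarith [Real.pi_pos, pow_pos Real.pi_pos 4]

/-- ★ **SECOND DIFFERENCES OF THE HALF-PROFILE** `g(v) = Θ(max(v, 0))`: `|g(v+η) − 2g(v) + g(v−η)| ≤ 12π²η² + 2π⁴η²` for `0 ≤ η ≤ 1` (interior: FILE 59; left of the junction: `0`; across
the junction: FILE 59 plus the flatness `1 − Θ ≤ 2π⁴(·)⁴`). [folklore] -/
theorem abs_halfP_second_diff_le {v η : ℝ} (hη : 0 ≤ η) (hη1 : η ≤ 1) :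
    |thetaP (max (v + η) 0) - 2 * thetaP (max v 0) + thetaP (max (v - η) 0)| ≤ 12 * π ^ 2 * η ^ 2 + 2 * π ^ 4 * η ^ 2 := by
  have hA : 0 ≤ 12 * π ^ 2 * η ^ 2 := by positivity
  have hB : 0 ≤ 2 * π ^ 4 * η ^ 2 := by positivity
  by_cases h1 : 0 ≤ v - η
  · -- interior: all three in the `Θ` region
    rw [thetaP_max_of_nonneg (by linarith : 0 ≤ v + η), thetaP_max_of_nonneg (by linarith : 0 ≤ v), thetaP_max_of_nonneg h1]
    exact (abs_thetaP_second_diff_le (t := v) hη hη1).trans (by linarith)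
  push Not at h1
  by_cases h2 : v + η ≤ 0
  · -- left of the junction: all three equal `1`
    rw [thetaP_max_of_nonpos h2, thetaP_max_of_nonpos (by linarith : v ≤ 0), thetaP_max_of_nonpos (by linarith : v - η ≤ 0)]
    norm_num; positivity
  push Not at h2
  by_cases h3 : 0 ≤ v
  · -- `v − η < 0 ≤ v`: FILE 59's second difference plus the flatness at `v − η`
    have key := abs_thetaP_second_diff_le (t := v) hη hη1
    have hflat : |thetaP (max (v - η) 0) - thetaP (v - η)| ≤ 2 * π ^ 4 * η ^ 2 := by
      rw [thetaP_max_of_nonpos h1.le, ← thetaP_neg (v - η), abs_of_nonneg (one_sub_thetaP_nonneg _)]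
      refine (one_sub_thetaP_le (by linarith) (by linarith)).trans ?_
      have h4 : (-(v - η)) ^ 4 ≤ η ^ 4 := pow_le_pow_left₀ (by linarith) (by linarith) 4
      have hη2 : η ^ 4 ≤ η ^ 2 := by nlinarith [sq_nonneg η, mul_le_one₀ hη1 hη hη1]
      nlinarith [Real.pi_pos, pow_pos Real.pi_pos 4]
    rw [thetaP_max_of_nonneg (by linarith : 0 ≤ v + η), thetaP_max_of_nonneg h3]
    have e : thetaP (v + η) - 2 * thetaP v + thetaP (max (v - η) 0) =
        (thetaP (v + η) - 2 * thetaP v + thetaP (v - η)) + (thetaP (max (v - η) 0) - thetaP (v - η)) := by ring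
    rw [e]
    exact (abs_add_le _ _).trans (add_le_add key hflat)
  · -- `v < 0 < v + η`: only the right sample leaves the plateau
    push Not at h3
    rw [thetaP_max_of_nonpos h3.le, thetaP_max_of_nonpos (by linarith : v - η ≤ 0),
      show thetaP (max (v + η) 0) - 2 * 1 + 1 = thetaP (max (v + η) 0) - 1 by ring]
    exact (abs_thetaP_max_sub_one_le (by linarith : v + η ≤ η) hη hη1).trans (by linarith)

/-- ★★ **THE SECOND-DIFFERENCE LETTER** `|B_R(t+η) − 2B_R(t) + B_R(t−η)| ≤ 16π⁴η²` for `0 ≤ η ≤ 1` and every `R ≥ 0` (on `|t| ≥ η` the three samples read the half-profile at `±t − R`;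
on `|t| < η` the reflected sample differs from the half-profile's by a flatness term `≤ 2π⁴η²`). [cite: Balaban1984PropagatorsII, (2.36) p.229 («|∂²h| ≤ O(1)M⁻²»: shape)] -/
theorem abs_bumpP_second_diff_le {R : ℝ} (hR : 0 ≤ R) {t η : ℝ} (hη : 0 ≤ η) (hη1 : η ≤ 1) : |bumpP R (t + η) - 2 * bumpP R t + bumpP R (t - η)| ≤ 16 * π ^ 4 * η ^ 2 := by
  have hπ1 : (1 : ℝ) ≤ π := by linarith [Real.pi_gt_three]
  have hπ2 : π ^ 2 ≤ π ^ 4 := by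
    have : (1 : ℝ) ≤ π ^ 2 := one_le_pow₀ hπ1
    nlinarith
  have hsum : 12 * π ^ 2 * η ^ 2 + 2 * π ^ 4 * η ^ 2 + 2 * π ^ 4 * η ^ 2 ≤ 16 * π ^ 4 * η ^ 2 := by nlinarith [sq_nonneg η]
  -- the one-sided statement for `t ≥ 0`
  have half : ∀ t : ℝ, 0 ≤ t → |bumpP R (t + η) - 2 * bumpP R t + bumpP R (t - η)| ≤ 16 * π ^ 4 * η ^ 2 := by
    intro t ht
    unfold bumpP
    rw [abs_of_nonneg (by linarith : 0 ≤ t + η), abs_of_nonneg ht]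
    have key := abs_halfP_second_diff_le (v := t - R) hη hη1
    rw [show t - R + η = t + η - R by ring, show t - R - η = t - η - R by ring] at key
    by_cases hcase : η ≤ t
    · rw [abs_of_nonneg (by linarith : 0 ≤ t - η)]
      exact key.trans (by linarith [show 0 ≤ 2 * π ^ 4 * η ^ 2 by positivity])
    · push Not at hcase
      rw [abs_of_neg (by linarith : t - η < 0)]
      -- compare the reflected sample `Θ(max(η − t − R, 0))` with the half-profile's `Θ(max(t − η − R, 0)) = 1`
      have e1 : thetaP (max (t - η - R) 0) = 1 := thetaP_max_of_nonpos (by linarith)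
      have hrefl : |thetaP (max (-(t - η) - R) 0) - thetaP (max (t - η - R) 0)| ≤ 2 * π ^ 4 * η ^ 2 := by
        rw [e1]; exact abs_thetaP_max_sub_one_le (by linarith) hη hη1
      have e : thetaP (max (t + η - R) 0) - 2 * thetaP (max (t - R) 0) + thetaP (max (-(t - η) - R) 0) =
          (thetaP (max (t + η - R) 0) - 2 * thetaP (max (t - R) 0) + thetaP (max (t - η - R) 0)) +
            (thetaP (max (-(t - η) - R) 0) - thetaP (max (t - η - R) 0)) := by ring
      rw [e]
      exact ((abs_add_le _ _).trans (add_le_add key hrefl)).trans hsum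
  rcases le_or_gt 0 t with ht | ht
  · exact half t ht
  · have key := half (-t) (by linarith)
    rw [show -t + η = -(t - η) by ring, show -t - η = -(t + η) by ring, bumpP_neg, bumpP_neg, bumpP_neg] at key
    rwa [show bumpP R (t + η) - 2 * bumpP R t + bumpP R (t - η) = bumpP R (t - η) - 2 * bumpP R t + bumpP R (t + η) by ring]

/-! ## §2 The plateau profile on the circle of `K` cells -/

/-- **THE PERIODIZED PLATEAU PROFILE** `B_{K,R} = B_R ∘ v_K`. [cite: Balaban1985BackgroundPropagators, (3.62)–(3.65) pp.402–403 (shape)] -/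
def bumpPer (K : ℕ) (R u : ℝ) : ℝ := bumpP R (cenRep K u)

/-- Period `K`. [folklore] -/
theorem bumpPer_add_int_mul {K : ℕ} (hK : 0 < K) (R u : ℝ) (j : ℤ) : bumpPer K R (u + j * K) = bumpPer K R u := by
  unfold bumpPer; rw [cenRep_add_int_mul hK]

/-- `0 ≤ B_{K,R}`. [folklore] -/
theorem bumpPer_nonneg (K : ℕ) (R u : ℝ) : 0 ≤ bumpPer K R u := bumpP_nonneg _ _

/-- `|B_{K,R}| ≤ 1`. [folklore] -/
theorem abs_bumpPer_le_one (K : ℕ) (R u : ℝ) : |bumpPer K R u| ≤ 1 := abs_bumpP_le_one _ _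

/-- `B_{K,R} ≤ 1`. [folklore] -/
theorem bumpPer_le_one (K : ℕ) (R u : ℝ) : bumpPer K R u ≤ 1 := bumpP_le_one _ _

/-- ★ **THE PLATEAU on the circle**: `|v_K(u)| ≤ R ⟹ B_{K,R}(u) = 1`. [cite: Balaban1985BackgroundPropagators, (3.62)–(3.65) pp.402–403 (shape)] -/
theorem bumpPer_eq_one_of_abs_cenRep_le {K : ℕ} {R u : ℝ} (h : |cenRep K u| ≤ R) : bumpPer K R u = 1 := bumpP_eq_one_of_abs_le h

/-- ★ **THE SUPPORT on the circle**: `R + 1 ≤ |v_K(u)| ⟹ B_{K,R}(u) = 0`. [cite: Balaban1985BackgroundPropagators, (3.62)–(3.65) pp.402–403 (shape)] -/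
theorem bumpPer_eq_zero_of_le_abs_cenRep {K : ℕ} {R u : ℝ} (h : R + 1 ≤ |cenRep K u|) : bumpPer K R u = 0 := bumpP_eq_zero_of_le_abs h

/-- Contrapositive of the support statement: `B_{K,R}(u) ≠ 0 ⟹ |v_K(u)| < R + 1`. [folklore] -/
theorem abs_cenRep_lt_of_bumpPer_ne_zero {K : ℕ} {R u : ℝ} (h : bumpPer K R u ≠ 0) : |cenRep K u| < R + 1 := by
  by_contra hc
  exact h (bumpPer_eq_zero_of_le_abs_cenRep (not_lt.1 hc))

/-- ★★ **THE GLOBAL LIPSCHITZ LETTER ON THE CIRCLE**: `|B_{K,R}(u) − B_{K,R}(u′)| ≤ π|u − u′|` for all `u, u′`, every `K ≥ 1` and every `R` (no seam condition: `B_R` reads `|v_K|`,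
which is 1-Lipschitz). [cite: Balaban1984PropagatorsII, (2.36) p.229 («|∂h| ≤ O(1)M⁻¹»: shape)] -/
theorem abs_bumpPer_sub_le {K : ℕ} (hK : 0 < K) (R u u' : ℝ) : |bumpPer K R u - bumpPer K R u'| ≤ π * |u - u'| := by
  unfold bumpPer
  exact (abs_bumpP_sub_le_abs_abs R _ _).trans (mul_le_mul_of_nonneg_left (abs_abs_cenRep_sub_le hK u u') Real.pi_pos.le)

/-- … and through the circle distance: `|B_{K,R}(u) − B_{K,R}(u′)| ≤ π|v_K(u − u′)|`. [folklore] -/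
theorem abs_bumpPer_sub_le_cenRep {K : ℕ} (hK : 0 < K) (R u u' : ℝ) : |bumpPer K R u - bumpPer K R u'| ≤ π * |cenRep K (u - u')| := by
  have hper := bumpPer_add_int_mul hK R u' (round ((u - u') / K))
  rw [← hper]
  refine (abs_bumpPer_sub_le hK R _ _).trans (le_of_eq ?_)
  unfold cenRep; congr 1; congr 1; ring

/-- ★ **ANY SMALL REPRESENTATIVE WILL DO**: for `K ≥ 2R + 4` and `|w| ≤ K∕2 + 1`, `B_R(v_K(w)) = B_R(w)` (either `v_K(w) = w`, or both `|w|` and `|v_K(w)|` are `≥ R + 1`). [folklore] -/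
theorem bumpP_cenRep_eq {K : ℕ} (hK : 0 < K) {R w : ℝ} (hRK : 2 * R + 4 ≤ K) (hw : |w| ≤ K / 2 + 1) : bumpP R (cenRep K w) = bumpP R w := by
  have hKr : (0 : ℝ) < K := by exact_mod_cast hK
  by_cases h0 : round (w / K) = 0
  · unfold cenRep; rw [h0]; push_cast; rw [mul_zero, sub_zero]
  · -- `round(w∕K) ≠ 0 ⟹ |w| ≥ K∕2`, and the representative is at distance `≥ K − |w| ≥ K∕2 − 1` from `0`
    have hw2 : (K : ℝ) / 2 ≤ |w| := by
      by_contra hc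
      push Not at hc
      refine h0 (round_eq_zero_iff.2 ⟨?_, ?_⟩)
      · rw [le_div_iff₀ hKr]; have := neg_abs_le w; linarith
      · rw [div_lt_iff₀ hKr]; have := le_abs_self w; linarith
    have hm1 : (1 : ℝ) ≤ |(round (w / K) : ℝ)| := by
      have : (1 : ℤ) ≤ |round (w / K)| := Int.one_le_abs h0
      exact_mod_cast this
    have hv : (K : ℝ) / 2 - 1 ≤ |cenRep K w| := by
      unfold cenRep
      have h1 : |(K : ℝ) * (round (w / K) : ℝ)| - |w| ≤ |w - K * (round (w / K) : ℝ)| := by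
        have := abs_sub_abs_le_abs_sub ((K : ℝ) * (round (w / K) : ℝ)) w
        rwa [abs_sub_comm ((K : ℝ) * _) w] at this
      have h2 : (K : ℝ) ≤ |(K : ℝ) * (round (w / K) : ℝ)| := by
        rw [abs_mul, abs_of_pos hKr]; nlinarith
      linarith
    rw [bumpP_eq_zero_of_le_abs (by linarith : R + 1 ≤ |cenRep K w|), bumpP_eq_zero_of_le_abs (by linarith : R + 1 ≤ |w|)]

/-- ★★ **THE SECOND-DIFFERENCE LETTER ON THE CIRCLE**: `|B_{K,R}(u+s) − 2B_{K,R}(u) + B_{K,R}(u−s)| ≤ 16π⁴s²` for `0 ≤ s ≤ 1`, `K ≥ 2R + 4` (the three samples read `B_R` at the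
common representative `v_K(u), v_K(u) ± s`, by `bumpP_cenRep_eq`). [cite: Balaban1984PropagatorsII, (2.36) p.229 («|∂²h| ≤ O(1)M⁻²»: shape)] -/
theorem abs_bumpPer_second_diff_le {K : ℕ} (hK : 0 < K) {R : ℝ} (hR : 0 ≤ R) (hRK : 2 * R + 4 ≤ K) {u s : ℝ} (hs : 0 ≤ s) (hs1 : s ≤ 1) :
    |bumpPer K R (u + s) - 2 * bumpPer K R u + bumpPer K R (u - s)| ≤ 16 * π ^ 4 * s ^ 2 := by
  have hc := abs_cenRep_le hK u
  set c := cenRep K u with hcdef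
  have hu : u = c + (round (u / K) : ℤ) * K := by rw [hcdef]; unfold cenRep; ring
  have ep : bumpPer K R (u + s) = bumpP R (c + s) := by
    unfold bumpPer
    rw [hu, show c + (round (u / K) : ℤ) * K + s = (c + s) + (round (u / K) : ℤ) * K by ring, cenRep_add_int_mul hK]
    exact bumpP_cenRep_eq hK hRK (by have := abs_add_le c s; rw [abs_of_nonneg hs] at this; linarith)
  have em : bumpPer K R (u - s) = bumpP R (c - s) := by
    unfold bumpPer
    rw [hu, show c + (round (u / K) : ℤ) * K - s = (c - s) + (round (u / K) : ℤ) * K by ring, cenRep_add_int_mul hK]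
    exact bumpP_cenRep_eq hK hRK (by have := abs_sub c s; rw [abs_of_nonneg hs] at this; linarith)
  have e0 : bumpPer K R u = bumpP R c := by
    unfold bumpPer
    conv_lhs => rw [hu, cenRep_add_int_mul hK]
    exact bumpP_cenRep_eq hK hRK (by linarith)
  rw [ep, em, e0]
  exact abs_bumpP_second_diff_le hR hs hs1

end Summit.QuantumFields.YangMills.BalabanUVNodes.N15.Gluing

end
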